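import Mathlib.RingTheory.Localization.LocalizationLocalization
import Summits.Ventures.HSemireg.EmbeddedFirstOrderDeformationsCechObstruction
import Summits.Ventures.HSemireg.EmbeddedFirstOrderDeformationsLiftGluing

/-!
# Venture HSemireg — the Čech obstruction of an AFFINE thickening on a basic-open atlas: atlas lifts of `Z` are
# the global flat lifts, so «the cochain is a coboundary ⟺ `Z` lifts globally» (Hartshorne, *Deformation Theory*,
# Thm. 6.2 (b) in ATLAS FORM — the Čech level of `…CechObstruction`, not the printed `H¹(𝒩)` form — + the sheaf
# property; the affine building block of «the class does not depend on the cover»)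

HONEST FRAMING.  Lean side of the computation cell `pub-hsemireg` (track «S4-PUSH» (ii), seat s4-prove-3 g6, second
route for (S5)); log `s4push/prove-3/ATTEMPT-10.md` (file VII of the ATTEMPT-9 package; s4-ref g34 P-1 folded).  Plain
commutative algebra: a flat first-order thickening `π : R' ↠ R` of an AFFINE `Spec R`, a finite family `(f_α)`
generating the unit ideal,
the localisations `A_α = R'_{f_α} ↠ B_α = R_{π f_α}` (charts) and `T_αβ = R'_{f_α f_β} ↠ U_αβ = R_{π(f_α f_β)}`
(overlaps) with the canonical restriction maps.  No Mathlib scheme, sheaf, Čech-to-derived comparison, abelian variety or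
semiregularity map is constructed; nothing here says that HC, HC_CM or HC_AV holds; no object is certified; no
Literature fact is declared.

WHAT (namespace `Summit.Ventures.HSemireg.EmbeddedDeformation`):
* §1 `locRes M N` — the restriction `R'_M → R'_N` between two localisations when every element of `M` divides an
  element of `N` (`D(f_α f_β) ⊆ D(f_α)`); it is a morphism of the localised thickenings (`isThickeningHom_locRes`),
  `R'_N` is the localisation of `R'_M` at the image of `N` (`isLocalization_map_of_dvd`), and **`locRes` CARRIES
  FLAT LIFTS TO FLAT LIFTS** (`preservesLifts_locRes`, from `…TorsorLocalization`).
* §2 **`thickenedAtlas_away`** — the charts `A_α ↠ B_α`, overlaps `T_αβ ↠ U_αβ` and the four canonical restrictions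
  form a `ThickenedAtlas` (`…CechObstruction`) for the subscheme `I·B_α`, `I·U_αβ` — the STANDARD AFFINE INSTANCE of
  the abstract atlas (non-vacuity of every hypothesis of Thm. 6.2 (b), atlas form, beyond the one-chart case).
* §3 `map_locRes_eq_iff` — agreement of two chart ideals on the overlap, `J_α·T_αβ = J_β·T_αβ`, is EQUIVALENT to
  the element-wise compatibility of `…LiftGluing`; hence **`isAtlasLift_away_iff`**: a lift of `Z` to the basic-open
  atlas is exactly a compatible family of local flat lifts, and **`exists_isAtlasLift_away_iff_exists_isLift`**:
  `Z` lifts to the atlas ⟺ `I` has a GLOBAL flat lift to `π` (sheaf property `liftEquivCompatibleFamily`).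
* §4 **`exists_isLift_iff_cechCochain_eq_coboundary`** — for ANY local flat lifts `T_α` on the charts: a global flat
  lift of `I` exists ⟺ the Čech cochain `(T_β| − T_α|)_αβ` is a coboundary;
  **`cechCochain_eq_coboundary_of_section`** — if the thickening splits (e.g. `R` formally smooth,
  `…SmoothSplitting`) the cochain IS a coboundary; **`cechCochain_coboundary_iff_of_covers`** — COVER INDEPENDENCE
  on an affine: for two finite basic-open covers and any local lifts, coboundary for one ⟺ coboundary for the
  other (the affine building block of «the obstruction class does not depend on the affine cover»); the general
  refinement statement and Čech-vs-sheaf `H¹` are NOT typed here.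

References: R. Hartshorne, *Deformation Theory*, GTM 257 (2010), §6 Thm. 6.2 and its proof [corpus:
book:springernd-deformation-theory p0054–p0056]; §2 Thm. 2.4 («compatible with localization»).
-/

namespace Summit.Ventures.HSemireg

namespace EmbeddedDeformation

universe w w' u v u' v' u'' v''

/-! ### §1 Restriction between two localisations of one thickening -/

section LocRes

variable {R' : Type u} {R : Type v} [CommRing R'] [CommRing R] {π : R' →+* R} {e : R'}
variable (M N : Submonoid R')
variable (S : Type u') [CommRing S] [Algebra R' S] [IsLocalization M S]
variable (P : Type u'') [CommRing P] [Algebra R' P] [IsLocalization N P]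

/-- If every element of `M` divides an element of `N`, the elements of `M` become units in `R'_N`. [folklore] -/
theorem isUnit_algebraMap_of_dvd (h : ∀ m ∈ M, ∃ n ∈ N, m ∣ n) (m : M) : IsUnit (algebraMap R' P m) := by
  obtain ⟨n, hn, hd⟩ := h m m.2
  exact isUnit_of_dvd_unit (map_dvd _ hd) (IsLocalization.map_units P ⟨n, hn⟩)

/-- **The restriction map `R'_M → R'_N`** (`D(N) ⊆ D(M)`, e.g. `R'_{f_α} → R'_{f_α f_β}`): the localisation
universal property. [folklore] -/
noncomputable def locRes (h : ∀ m ∈ M, ∃ n ∈ N, m ∣ n) : S →+* P :=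
  IsLocalization.lift (M := M) (S := S) (g := algebraMap R' P) (isUnit_algebraMap_of_dvd M N P h)

variable {M N} in
/-- `locRes (x/1) = x/1`. [folklore] -/
theorem locRes_algebraMap (h : ∀ m ∈ M, ∃ n ∈ N, m ∣ n) (x : R') :
    locRes M N S P h (algebraMap R' S x) = algebraMap R' P x :=
  IsLocalization.lift_eq _ x

variable {M N} in
/-- The divisibility hypothesis passes to the images `π(M)`, `π(N)`. [folklore] -/
theorem dvd_map (h : ∀ m ∈ M, ∃ n ∈ N, m ∣ n) : ∀ m ∈ M.map π, ∃ n ∈ N.map π, m ∣ n := by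
  rintro _ ⟨m, hm, rfl⟩
  obtain ⟨n, hn, hd⟩ := h m hm
  exact ⟨π n, ⟨n, hn, rfl⟩, map_dvd π hd⟩

/-- **`R'_N` is the localisation of `R'_M` at the image of `N`** (for any compatible `R'_M`-algebra structure):
`R'_N = (M ⊔ N)⁻¹R'` since `M` divides into `N`; `= (R'_M)_{M ⊔ N}`; and `M ⊔ N` may be replaced by `N` over
`R'_M` because `M` consists of units there. [folklore] -/
theorem isLocalization_map_of_dvd (h : ∀ m ∈ M, ∃ n ∈ N, m ∣ n) [Algebra S P] [IsScalarTower R' S P] :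
    IsLocalization (N.map (algebraMap R' S)) P := by
  have hL : IsLocalization (M ⊔ N) P := by
    refine IsLocalization.of_le_of_exists_dvd N (M ⊔ N) le_sup_right fun l hl ↦ ?_
    obtain ⟨m, hm, n, hn, rfl⟩ := Submonoid.mem_sup.1 hl
    obtain ⟨n₀, hn₀, hd⟩ := h m hm
    exact ⟨n₀ * n, N.mul_mem hn₀ hn, mul_dvd_mul_right hd n⟩
  have hLS : IsLocalization ((M ⊔ N).map (algebraMap R' S)) P :=
    IsLocalization.isLocalization_of_submonoid_le S P M (M ⊔ N) le_sup_left
  refine (IsLocalization.iff_of_le_of_exists_dvd (N.map (algebraMap R' S)) ((M ⊔ N).map (algebraMap R' S))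
    (Submonoid.monotone_map le_sup_right) ?_).2 hLS
  rintro _ ⟨l, hl, rfl⟩
  obtain ⟨m, hm, n, hn, rfl⟩ := Submonoid.mem_sup.1 hl
  refine ⟨algebraMap R' S n, ⟨n, hn, rfl⟩, ?_⟩
  rw [map_mul]
  exact (IsUnit.mul_left_dvd (IsLocalization.map_units S ⟨m, hm⟩)).2 dvd_rfl

variable (Sb : Type v') [CommRing Sb] [Algebra R Sb] [IsLocalization (M.map π) Sb]
variable (Pb : Type v'') [CommRing Pb] [Algebra R Pb] [IsLocalization (N.map π) Pb]

/-- **`locRes` is a morphism of the localised thickenings** `(π_M : R'_M ↠ R_{π M}) → (π_N : R'_N ↠ R_{π N})` over the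
base restriction `R_{π M} → R_{π N}` (both composites agree on `R'`). [cite: Hartshorne2010, §2 Thm. 2.4] -/
theorem isThickeningHom_locRes (h : ∀ m ∈ M, ∃ n ∈ N, m ∣ n) :
    IsThickeningHom (locMap π M S Sb) (algebraMap R' S e) (locMap π N P Pb) (algebraMap R' P e)
      (locRes M N S P h) (locRes (M.map π) (N.map π) Sb Pb (dvd_map h)) where
  comm z := by
    have key : (locMap π N P Pb).comp (locRes M N S P h) =
        (locRes (M.map π) (N.map π) Sb Pb (dvd_map h)).comp (locMap π M S Sb) := by
      refine IsLocalization.ringHom_ext M ?_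
      ext x
      simp only [RingHom.comp_apply, locRes_algebraMap, locMap_algebraMap]
    exact DFunLike.congr_fun key z
  map_eps := locRes_algebraMap S P h e

/-- **`locRes` carries flat lifts to flat lifts**: for a flat lift `K` of `I·R_{π M}` to `π_M`, `K·R'_N` is a flat
lift of `I·R_{π N}` to `π_N` — `…TorsorLocalization`'s `IsLift.localization` applied to `π_M` and the presentation
of `R'_N` as a localisation of `R'_M` (`isLocalization_map_of_dvd`). [cite: Hartshorne2010, §2 Thm. 2.4] -/
theorem preservesLifts_locRes (h : ∀ m ∈ M, ∃ n ∈ N, m ∣ n) (I : Ideal R) :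
    PreservesLifts (locMap π M S Sb) (algebraMap R' S e) (locMap π N P Pb) (algebraMap R' P e)
      (locRes M N S P h) (I.map (algebraMap R Sb)) (I.map (algebraMap R Pb)) := by
  letI algSP : Algebra S P := (locRes M N S P h).toAlgebra
  haveI : IsScalarTower R' S P := IsScalarTower.of_algebraMap_eq fun x ↦ (locRes_algebraMap S P h x).symm
  haveI hNP : IsLocalization (N.map (algebraMap R' S)) P := isLocalization_map_of_dvd M N S P h
  letI algb : Algebra Sb Pb := (locRes (M.map π) (N.map π) Sb Pb (dvd_map h)).toAlgebra
  haveI : IsScalarTower R Sb Pb :=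
    IsScalarTower.of_algebraMap_eq fun x ↦ (locRes_algebraMap Sb Pb (dvd_map (π := π) h) x).symm
  have hsub : (N.map (algebraMap R' S)).map (locMap π M S Sb) = (N.map π).map (algebraMap R Sb) := by
    ext y
    simp only [Submonoid.mem_map, exists_exists_and_eq_and, locMap_algebraMap]
  haveI hNPb : IsLocalization ((N.map (algebraMap R' S)).map (locMap π M S Sb)) Pb := by
    rw [hsub]
    exact isLocalization_map_of_dvd (M.map π) (N.map π) Sb Pb (dvd_map h)
  intro K hK
  have hK' := hK.localization (N.map (algebraMap R' S)) P Pb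
  have h1 : locMap (locMap π M S Sb) (N.map (algebraMap R' S)) P Pb = locMap π N P Pb := by
    refine IsLocalization.ringHom_ext N ?_
    ext x
    rw [RingHom.comp_apply, RingHom.comp_apply, locMap_algebraMap, IsScalarTower.algebraMap_apply R' S P x,
      locMap_algebraMap, locMap_algebraMap, ← IsScalarTower.algebraMap_apply R Sb Pb]
  have h2 : algebraMap S P (algebraMap R' S e) = algebraMap R' P e := (IsScalarTower.algebraMap_apply R' S P e).symm
  have h3 : (I.map (algebraMap R Sb)).map (algebraMap Sb Pb) = I.map (algebraMap R Pb) := by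
    rw [Ideal.map_map, ← IsScalarTower.algebraMap_eq R Sb Pb]
  rw [h1, h2, h3] at hK'
  exact hK'

variable (M₂ : Submonoid R') (S₂ : Type w) [CommRing S₂] [Algebra R' S₂] [IsLocalization M₂ S₂]

/-- **Two chart ideals compared on a common overlap.**  For localisations `R'_{M}`, `R'_{M₂}` both restricting to
`R'_N` (`locRes`) and ideals `J ⊆ R'_M`, `J₂ ⊆ R'_{M₂}`: `J·R'_N ≤ J₂·R'_N` iff every `x ∈ R'` with `x/1 ∈ J` has
`n x/1 ∈ J₂` for some `n ∈ N` — the element-wise compatibility of `…LiftGluing`, read on the overlap ring.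
(⇒: `x/1 ∈ J₂·R'_N = (J₂)_{N}`; ⇐: write `j = a/m`, then `j = (n a)/(n m)` with `n a/1 ∈ J₂` and `n m` a unit.)
[folklore] -/
theorem map_locRes_le_iff (h : ∀ m ∈ M, ∃ n ∈ N, m ∣ n) (h₂ : ∀ m ∈ M₂, ∃ n ∈ N, m ∣ n) (J : Ideal S)
    (J₂ : Ideal S₂) :
    J.map (locRes M N S P h) ≤ J₂.map (locRes M₂ N S₂ P h₂) ↔
      ∀ x : R', algebraMap R' S x ∈ J → ∃ n ∈ N, algebraMap R' S₂ (n * x) ∈ J₂ := by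
  -- `P` as the localisation of `S₂` at the image of `N`, along `locRes M₂ N`
  letI alg₂ : Algebra S₂ P := (locRes M₂ N S₂ P h₂).toAlgebra
  haveI : IsScalarTower R' S₂ P := IsScalarTower.of_algebraMap_eq fun x ↦ (locRes_algebraMap S₂ P h₂ x).symm
  haveI hloc : IsLocalization (N.map (algebraMap R' S₂)) P := isLocalization_map_of_dvd M₂ N S₂ P h₂
  constructor
  · intro hle x hx
    have hxP : algebraMap R' P x ∈ J₂.map (locRes M₂ N S₂ P h₂) := by
      have := hle (Ideal.mem_map_of_mem (locRes M N S P h) hx)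
      rwa [locRes_algebraMap] at this
    rw [IsScalarTower.algebraMap_apply R' S₂ P x] at hxP
    obtain ⟨_, ⟨n, hn, rfl⟩, hnx⟩ := (IsLocalization.algebraMap_mem_map_algebraMap_iff
      (N.map (algebraMap R' S₂)) P J₂ (algebraMap R' S₂ x)).1 hxP
    exact ⟨n, hn, by rwa [map_mul]⟩
  · intro hc
    rw [Ideal.map_le_iff_le_comap]
    intro j hj
    rw [Ideal.mem_comap]
    obtain ⟨⟨a, m⟩, hja⟩ := IsLocalization.surj M j
    -- `j · m/1 = a/1` in `R'_M`, so `a/1 ∈ J`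
    have ha : algebraMap R' S a ∈ J := by
      rw [← hja]
      exact J.mul_mem_right _ hj
    obtain ⟨n, hn, hna⟩ := hc a ha
    have hnaP : algebraMap R' P (n * a) ∈ J₂.map (locRes M₂ N S₂ P h₂) := by
      have := Ideal.mem_map_of_mem (locRes M₂ N S₂ P h₂) hna
      rwa [locRes_algebraMap] at this
    have hj' : locRes M N S P h j * algebraMap R' P m = algebraMap R' P a := by
      have := congrArg (locRes M N S P h) hja
      rwa [map_mul, locRes_algebraMap, locRes_algebraMap] at this
    have hprod : locRes M N S P h j * (algebraMap R' P m * algebraMap R' P n) = algebraMap R' P (n * a) := by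
      rw [← mul_assoc, hj', ← map_mul, mul_comm]
    have hu : IsUnit (algebraMap R' P m * algebraMap R' P n) :=
      (isUnit_algebraMap_of_dvd M N P h m).mul (IsLocalization.map_units P ⟨n, hn⟩)
    have hmem : locRes M N S P h j * (algebraMap R' P m * algebraMap R' P n) ∈ J₂.map (locRes M₂ N S₂ P h₂) := by
      rw [hprod]
      exact hnaP
    exact (Ideal.mul_unit_mem_iff_mem _ hu).1 hmem

end LocRes
/-! ### §2 The basic-open thickened atlas of an affine thickening -/

section Away

variable {R' : Type u} {R : Type v} [CommRing R'] [CommRing R] {π : R' →+* R} {e : R'}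
variable {ι : Type w} (f : ι → R')
variable (A : ι → Type u') [∀ α, CommRing (A α)] [∀ α, Algebra R' (A α)] [∀ α, IsLocalization.Away (f α) (A α)]
variable (B : ι → Type v') [∀ α, CommRing (B α)] [∀ α, Algebra R (B α)]
  [∀ α, IsLocalization ((Submonoid.powers (f α)).map π) (B α)]
variable (T : ι → ι → Type u'') [∀ α β, CommRing (T α β)] [∀ α β, Algebra R' (T α β)]
  [∀ α β, IsLocalization (Submonoid.powers (f α * f β)) (T α β)]
variable (U : ι → ι → Type v'') [∀ α β, CommRing (U α β)] [∀ α β, Algebra R (U α β)]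
  [∀ α β, IsLocalization ((Submonoid.powers (f α * f β)).map π) (U α β)]

/-- `f_α^i ∣ (f_α f_β)^i`: `D(f_α f_β) ⊆ D(f_α)`. [folklore] -/
theorem powers_dvd_powers_mul_left (α β : ι) :
    ∀ m ∈ Submonoid.powers (f α), ∃ n ∈ Submonoid.powers (f α * f β), m ∣ n := by
  rintro _ ⟨i, rfl⟩; exact ⟨(f α * f β) ^ i, ⟨i, rfl⟩, pow_dvd_pow_of_dvd (dvd_mul_right _ _) i⟩

/-- `f_β^i ∣ (f_α f_β)^i`: `D(f_α f_β) ⊆ D(f_β)`. [folklore] -/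
theorem powers_dvd_powers_mul_right (α β : ι) :
    ∀ m ∈ Submonoid.powers (f β), ∃ n ∈ Submonoid.powers (f α * f β), m ∣ n := by
  rintro _ ⟨i, rfl⟩; exact ⟨(f α * f β) ^ i, ⟨i, rfl⟩, pow_dvd_pow_of_dvd (dvd_mul_left _ _) i⟩

/-- Left restriction of the basic-open atlas, thickened side: `A_α = R'_{f_α} → T_αβ = R'_{f_α f_β}`. [folklore] -/
noncomputable abbrev awayResL (α β : ι) : A α →+* T α β :=
  locRes (Submonoid.powers (f α)) (Submonoid.powers (f α * f β)) (A α) (T α β)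
    (powers_dvd_powers_mul_left f α β)

/-- Right restriction, thickened side: `A_β → T_αβ`. [folklore] -/
noncomputable abbrev awayResR (α β : ι) : A β →+* T α β :=
  locRes (Submonoid.powers (f β)) (Submonoid.powers (f α * f β)) (A β) (T α β)
    (powers_dvd_powers_mul_right f α β)

variable (π) in
/-- Left restriction, base side: `B_α = R_{π f_α} → U_αβ = R_{π(f_α f_β)}`. [folklore] -/
noncomputable abbrev awayResLb (α β : ι) : B α →+* U α β :=
  locRes ((Submonoid.powers (f α)).map π) ((Submonoid.powers (f α * f β)).map π) (B α) (U α β)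
    (dvd_map (powers_dvd_powers_mul_left f α β))

variable (π) in
/-- Right restriction, base side: `B_β → U_αβ`. [folklore] -/
noncomputable abbrev awayResRb (α β : ι) : B β →+* U α β :=
  locRes ((Submonoid.powers (f β)).map π) ((Submonoid.powers (f α * f β)).map π) (B β) (U α β)
    (dvd_map (powers_dvd_powers_mul_right f α β))

/-- **THE BASIC-OPEN THICKENED ATLAS of an affine flat first-order thickening** `π : R' ↠ R` and a family `(f_α)`:
charts `π_α : R'_{f_α} ↠ R_{π f_α}`, overlaps `π_αβ : R'_{f_α f_β} ↠ R_{π(f_α f_β)}` (parameter `e/1`), the four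
canonical restrictions, subscheme `I·R_{π f_α}`, `I·R_{π(f_α f_β)}` — every hypothesis of `ThickenedAtlas` holds
(`…TorsorLocalization` + §1).  Non-vacuity of the abstract atlas beyond one chart. [cite: Hartshorne2010, §6 Thm.
6.2 (setting); §2 Thm. 2.4] -/
theorem thickenedAtlas_away (hT : IsFirstOrderThickening π e) (I : Ideal R) :
    ThickenedAtlas (fun α ↦ locMap π (Submonoid.powers (f α)) (A α) (B α)) (fun α ↦ algebraMap R' (A α) e)
      (fun α β ↦ locMap π (Submonoid.powers (f α * f β)) (T α β) (U α β))
      (fun α β ↦ algebraMap R' (T α β) e) (awayResL f A T) (awayResLb π f B U) (awayResR f A T)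
      (awayResRb π f B U) (fun α ↦ I.map (algebraMap R (B α))) fun α β ↦ I.map (algebraMap R (U α β)) where
  thick α := hT.localization (Submonoid.powers (f α)) (A α) (B α)
  thick₂ α β := hT.localization (Submonoid.powers (f α * f β)) (T α β) (U α β)
  homl α β := isThickeningHom_locRes _ _ (A α) (T α β) (B α) (U α β) (powers_dvd_powers_mul_left f α β)
  homr α β := isThickeningHom_locRes _ _ (A β) (T α β) (B β) (U α β) (powers_dvd_powers_mul_right f α β)
  liftsl α β := preservesLifts_locRes _ _ (A α) (T α β) (B α) (U α β) (powers_dvd_powers_mul_left f α β) I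
  liftsr α β := preservesLifts_locRes _ _ (A β) (T α β) (B β) (U α β) (powers_dvd_powers_mul_right f α β) I

/-! ### §3 Atlas lifts of `Z` on the basic-open atlas are the compatible families, i.e. the global flat lifts -/

variable {A} in
/-- On `R'_{f_β}` the factor `f_β` is a unit: `∃ n ∈ (f_α f_β)^ℕ, n x/1 ∈ J ⟺ ∃ m, f_α^m x/1 ∈ J`. [folklore] -/
theorem exists_powers_mul_iff (α β : ι) (J : Ideal (A β)) (x : R') :
    (∃ n ∈ Submonoid.powers (f α * f β), algebraMap R' (A β) (n * x) ∈ J) ↔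
      ∃ m : ℕ, algebraMap R' (A β) (f α ^ m * x) ∈ J := by
  have hu : ∀ i : ℕ, IsUnit (algebraMap R' (A β) (f β ^ i)) := fun i ↦ by
    rw [map_pow]
    exact (IsLocalization.map_units (A β) ⟨f β, Submonoid.mem_powers _⟩).pow i
  have hrw : ∀ i : ℕ, (f α * f β) ^ i * x = f β ^ i * (f α ^ i * x) := fun i ↦ by ring
  constructor
  · rintro ⟨_, ⟨i, rfl⟩, hi⟩
    rw [hrw, map_mul] at hi
    exact ⟨i, (Ideal.unit_mul_mem_iff_mem _ (hu i)).1 hi⟩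
  · rintro ⟨i, hi⟩
    refine ⟨(f α * f β) ^ i, ⟨i, rfl⟩, ?_⟩
    rw [hrw, map_mul]
    exact (Ideal.unit_mul_mem_iff_mem _ (hu i)).2 hi

variable {A} in
/-- The same with the roles of `f_α`, `f_β` exchanged (`f_α` is a unit on `R'_{f_α}`). [folklore] -/
theorem exists_powers_mul_iff' (α β : ι) (J : Ideal (A α)) (x : R') :
    (∃ n ∈ Submonoid.powers (f α * f β), algebraMap R' (A α) (n * x) ∈ J) ↔
      ∃ m : ℕ, algebraMap R' (A α) (f β ^ m * x) ∈ J := by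
  rw [mul_comm (f α) (f β)]
  exact exists_powers_mul_iff f β α J x

/-- **A lift of `Z` to the basic-open atlas IS a compatible family of local flat lifts** (`…LiftGluing`'s data):
local flat lifts `J_α` with `J_α·T_αβ = J_β·T_αβ` for all `α, β` ⟺ local flat lifts with the element-wise
compatibility in both directions. [cite: Hartshorne2010, §6 Thm. 6.2 (b) («which then glue»)] -/
theorem isAtlasLift_away_iff {I : Ideal R} {J : ∀ α, Ideal (A α)} :
    IsAtlasLift (fun α ↦ locMap π (Submonoid.powers (f α)) (A α) (B α)) (fun α ↦ algebraMap R' (A α) e)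
        (awayResL f A T) (awayResR f A T) (fun α ↦ I.map (algebraMap R (B α))) J ↔
      (∀ α, IsLift (locMap π (Submonoid.powers (f α)) (A α) (B α)) (algebraMap R' (A α) e)
          (I.map (algebraMap R (B α))) (J α)) ∧
        ∀ α β (x : R'), algebraMap R' (A α) x ∈ J α → ∃ m : ℕ, algebraMap R' (A β) (f α ^ m * x) ∈ J β := by
  have key : ∀ α β, (J α).map (awayResL f A T α β) = (J β).map (awayResR f A T α β) ↔
      (∀ x : R', algebraMap R' (A α) x ∈ J α → ∃ m : ℕ, algebraMap R' (A β) (f α ^ m * x) ∈ J β) ∧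
        ∀ x : R', algebraMap R' (A β) x ∈ J β → ∃ m : ℕ, algebraMap R' (A α) (f β ^ m * x) ∈ J α := by
    intro α β
    rw [le_antisymm_iff, map_locRes_le_iff, map_locRes_le_iff]
    refine and_congr (forall_congr' fun x ↦ imp_congr_right fun _ ↦ exists_powers_mul_iff f α β (J β) x)
      (forall_congr' fun x ↦ imp_congr_right fun _ ↦ exists_powers_mul_iff' f α β (J α) x)
  constructor
  · intro hJ
    exact ⟨hJ.isLift, fun α β ↦ ((key α β).1 (hJ.compat α β)).1⟩
  · rintro ⟨hl, hc⟩
    exact ⟨hl, fun α β ↦ (key α β).2 ⟨hc α β, hc β α⟩⟩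

variable [Fintype ι]

/-- **`Z` LIFTS TO THE BASIC-OPEN ATLAS ⟺ `I` HAS A GLOBAL FLAT LIFT TO `π`** (the sheaf property of flat lifts,
`…LiftGluing`: glue a compatible family with `glued`, restrict a global lift with `K ↦ K·R'_{f_α}`); here
`(f_α) = R'` and the index set is finite. [cite: Hartshorne2010, §6 Thm. 6.2 (b)] -/
theorem exists_isAtlasLift_away_iff_exists_isLift (hT : IsFirstOrderThickening π e)
    (hf : Ideal.span (Set.range f) = ⊤) (I : Ideal R) :
    (∃ J : ∀ α, Ideal (A α),
        IsAtlasLift (fun α ↦ locMap π (Submonoid.powers (f α)) (A α) (B α)) (fun α ↦ algebraMap R' (A α) e)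
          (awayResL f A T) (awayResR f A T) (fun α ↦ I.map (algebraMap R (B α))) J) ↔
      ∃ K : Ideal R', IsLift π e I K := by
  constructor
  · rintro ⟨J, hJ⟩
    obtain ⟨hl, hc⟩ := (isAtlasLift_away_iff f A B T).1 hJ
    exact ⟨glued A J, isLift_glued f A B hT hf hl hc⟩
  · rintro ⟨K, hK⟩
    exact ⟨fun α ↦ K.map (algebraMap R' (A α)), (isAtlasLift_away_iff f A B T).2
      ⟨fun α ↦ hK.localization (Submonoid.powers (f α)) (A α) (B α), compatible_map f K⟩⟩

/-! ### §4 On an affine: the Čech cochain is a coboundary iff `Z` lifts globally -/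

/-- **THE AFFINE ČECH CRITERION.**  Let `π : R' ↠ R` be a flat first-order thickening of an affine, `(f_α) = R'` a
finite family, and `T_α` ANY local flat lifts of `Z = V(I)` on the basic opens `D(f_α)`.  Then `Z` has a GLOBAL
flat lift across `π` if and only if the Čech cochain `(T_β|_{αβ} − T_α|_{αβ})` of the basic-open atlas is a
coboundary (`…CechObstruction`, Thm. 6.2 (b) atlas form + §3).  In particular, refining the one-chart atlas
`{Spec R'}` by basic opens does not change liftability: the affine building block of «the obstruction class does
not depend on the (affine) cover». [cite: Hartshorne2010, §6 Thm. 6.2 (b)] -/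
theorem exists_isLift_iff_cechCochain_eq_coboundary (hT : IsFirstOrderThickening π e)
    (hf : Ideal.span (Set.range f) = ⊤) (I : Ideal R) {T₀ : ∀ α, Ideal (A α)}
    (hT₀ : ∀ α, IsLift (locMap π (Submonoid.powers (f α)) (A α) (B α)) (algebraMap R' (A α) e)
      (I.map (algebraMap R (B α))) (T₀ α)) :
    (∃ K : Ideal R', IsLift π e I K) ↔
      ∃ φ : ∀ α, I.map (algebraMap R (B α)) →ₗ[B α] B α ⧸ I.map (algebraMap R (B α)),
        ∀ α β, cechCochain (thickenedAtlas_away f A B T U hT I) hT₀ α β =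
          resR (thickenedAtlas_away f A B T U hT I) hT₀ α β (φ β) -
            resL (thickenedAtlas_away f A B T U hT I) hT₀ α β (φ α) := by
  rw [← exists_isAtlasLift_away_iff_exists_isLift f A B T hT hf I]
  exact exists_isAtlasLift_iff (thickenedAtlas_away f A B T U hT I) hT₀

/-- **SPLIT AFFINE VANISHING.**  If the affine thickening SPLITS (a ring section `σ` of `π` — e.g. `R` formally
smooth: `…SmoothSplitting`'s `IsFirstOrderThickening.exists_section`), then for ANY local flat lifts on ANY finite
basic-open cover the Čech cochain IS a coboundary: the global lift `σ(I)·R'` exists (`…Cocycle`,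
`isLift_map_section`).  The affine shadow of «`H¹` of a quasi-coherent sheaf on an affine vanishes» for this
obstruction. [cite: Hartshorne2010, §6 Thm. 6.2 (b)] -/
theorem cechCochain_eq_coboundary_of_section (hT : IsFirstOrderThickening π e) (hf : Ideal.span (Set.range f) = ⊤)
    (I : Ideal R) (σ : R →+* R') (hσ : ∀ a, π (σ a) = a) {T₀ : ∀ α, Ideal (A α)}
    (hT₀ : ∀ α, IsLift (locMap π (Submonoid.powers (f α)) (A α) (B α)) (algebraMap R' (A α) e)
      (I.map (algebraMap R (B α))) (T₀ α)) :
    ∃ φ : ∀ α, I.map (algebraMap R (B α)) →ₗ[B α] B α ⧸ I.map (algebraMap R (B α)),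
      ∀ α β, cechCochain (thickenedAtlas_away f A B T U hT I) hT₀ α β =
        resR (thickenedAtlas_away f A B T U hT I) hT₀ α β (φ β) -
          resL (thickenedAtlas_away f A B T U hT I) hT₀ α β (φ α) :=
  (exists_isLift_iff_cechCochain_eq_coboundary f A B T U hT hf I hT₀).1 ⟨I.map σ, isLift_map_section hT σ hσ I⟩

/-- **COVER INDEPENDENCE ON AN AFFINE**: for two finite basic-open covers `(f_α) = R' = (g_a)` of one thickening
and ANY local flat lifts on them, the Čech cochain of the first is a coboundary iff that of the second is (both say
«`I` has a global flat lift», `exists_isLift_iff_cechCochain_eq_coboundary`). [cite: Hartshorne2010, §6 Thm. 6.2 (b)] -/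
theorem cechCochain_coboundary_iff_of_covers (hT : IsFirstOrderThickening π e) (hf : Ideal.span (Set.range f) = ⊤)
    {ι' : Type w'} [Fintype ι'] (g : ι' → R') (hg : Ideal.span (Set.range g) = ⊤)
    (A' : ι' → Type u') [∀ a, CommRing (A' a)] [∀ a, Algebra R' (A' a)] [∀ a, IsLocalization.Away (g a) (A' a)]
    (B' : ι' → Type v') [∀ a, CommRing (B' a)] [∀ a, Algebra R (B' a)]
    [∀ a, IsLocalization ((Submonoid.powers (g a)).map π) (B' a)]
    (T' : ι' → ι' → Type u'') [∀ a b, CommRing (T' a b)] [∀ a b, Algebra R' (T' a b)]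
    [∀ a b, IsLocalization (Submonoid.powers (g a * g b)) (T' a b)]
    (U' : ι' → ι' → Type v'') [∀ a b, CommRing (U' a b)] [∀ a b, Algebra R (U' a b)]
    [∀ a b, IsLocalization ((Submonoid.powers (g a * g b)).map π) (U' a b)]
    (I : Ideal R) {T₀ : ∀ α, Ideal (A α)} {T₀' : ∀ a, Ideal (A' a)}
    (hT₀ : ∀ α, IsLift (locMap π (Submonoid.powers (f α)) (A α) (B α)) (algebraMap R' (A α) e)
      (I.map (algebraMap R (B α))) (T₀ α))
    (hT₀' : ∀ a, IsLift (locMap π (Submonoid.powers (g a)) (A' a) (B' a)) (algebraMap R' (A' a) e)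
      (I.map (algebraMap R (B' a))) (T₀' a)) :
    (∃ φ : ∀ α, I.map (algebraMap R (B α)) →ₗ[B α] B α ⧸ I.map (algebraMap R (B α)),
        ∀ α β, cechCochain (thickenedAtlas_away f A B T U hT I) hT₀ α β =
          resR (thickenedAtlas_away f A B T U hT I) hT₀ α β (φ β) -
            resL (thickenedAtlas_away f A B T U hT I) hT₀ α β (φ α)) ↔
      ∃ φ' : ∀ a, I.map (algebraMap R (B' a)) →ₗ[B' a] B' a ⧸ I.map (algebraMap R (B' a)),
        ∀ a b, cechCochain (thickenedAtlas_away g A' B' T' U' hT I) hT₀' a b =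
          resR (thickenedAtlas_away g A' B' T' U' hT I) hT₀' a b (φ' b) -
            resL (thickenedAtlas_away g A' B' T' U' hT I) hT₀' a b (φ' a) :=
  (exists_isLift_iff_cechCochain_eq_coboundary f A B T U hT hf I hT₀).symm.trans
    (exists_isLift_iff_cechCochain_eq_coboundary g A' B' T' U' hT hg I hT₀')

end Away

end EmbeddedDeformation

end Summit.Ventures.HSemireg
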